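import Summits.Langlands.Langlands.Theorems.PhantomRMYoshidaResiduallyYoshidaLiftingRealisedClassSelmer
import Summits.Langlands.Langlands.Theorems.PhantomRMYoshidaResiduallyYoshidaLiftingGreenbergStablePlane
import HarnessLib

/-!
# Route `PhantomRMYoshida`, crux `ResiduallyYoshidaLifting` (stmt-Langlands-13639), line `sector-klingen-split`:
# stub K3⁺ `stub_realisedClassSelmerDec` — the realised class is Greenberg–Selmer for the DECOMPOSITION groups at `p`

Lead prover-line-stmt-Langlands-13639-c5-0 (continuation c5, skeleton rev 13, sub-goal K3⁺).

**Theorem (`stub_realisedClassSelmerDec`, registered signature verbatim).**  The cocycle `B : Γ_ℚ → M₂(k)` realised by an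
`Sh`-point `ρ` through an integral frame `(P, rint)` with reduction conjugator `h`, on a `DetC` fibre (`p ≠ 2`), is a
GREENBERG–SELMER cocycle for the ramification of `ρ` in the STRONG sense: (i) 1-cocycle, (ii) locally constant, (iii) vanishing on
the inertia groups above every place where `ρ` is unramified, (iv) at every `v ∣ p` the decomposition-group condition of N1⁺
(`G_v`-stable lines `k x₁ ⊆ σ̄`, `k y₁ ⊆ σ̄'` fixed by `I_v`; the corrected cocycle `B - δX₀` maps `y₁` into `k x₁` on `G_v`, kills
`y₁` on `I_v` and maps all of `σ̄'` into `k x₁` on `I_v`) — the residual Siegel-ordinary local condition of shape `(0,0,1,1)`.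

**Proof.**  Components (i)–(iii) are those of the landed K3 `Fibre.stub_realisedClassSelmer` (p160559); (iv) is the landed N1⁺
`Fibre.stub_greenbergStablePlane` (p168218).  No new definitions, no named fact taken as a hypothesis.
-/

noncomputable section

-- `Summit.Langlands.Langlands.…` (summit = sub-problem name, D-0017 layout) trips `dupNamespace` on every decl.
set_option linter.dupNamespace false
set_option autoImplicit false

open IsDedekindDomain Filter
open scoped Matrix
open Literature.NumberTheory.GaloisRepresentations Literature.NumberTheory.Automorphic
open Summit.Langlands.Langlands.Cruxes.ResiduallyYoshidaLifting.YoshidaDivisorSelmerCount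

namespace Summit.Langlands.Langlands.Cruxes.ResiduallyYoshidaLifting.SectorKlingenSplit.Fibre

/-- **Registered sub-goal K3⁺ `stub_realisedClassSelmerDec`** (crux stmt-Langlands-13639, line `sector-klingen-split`, skeleton
rev 13): the cocycle `B` realised by an `Sh`-point `ρ` on a `DetC` fibre (`p ≠ 2`) is a GREENBERG–SELMER cocycle for the
ramification of `ρ` in the strong, decomposition-group sense: (i) the 1-cocycle identity, (ii) locally constant, (iii) vanishing
on the inertia groups above every place where `ρ` is unramified, (iv) at every `v ∣ p` the nine clauses of N1⁺ (the residual
Siegel-ordinary local condition of shape `(0,0,1,1)`).  Bundles `Fibre.stub_realisedClassSelmer` (K3, first three components) and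
`Fibre.stub_greenbergStablePlane` (N1⁺). [folklore] -/
theorem stub_realisedClassSelmerDec :
    ∀ (p : ℕ) [Fact p.Prime], p ≠ 2 → ∀ (k : Type) [Field k] [CharP k p] [IsAlgClosed k]
      [TopologicalSpace k] [DiscreteTopology k] (red : Valued.integer (PadicAlgCl p) →+* k)
      (σ σ' : FramedGaloisRep ℚ k 2) (ρ : FramedGaloisRep ℚ (PadicAlgCl p) 4)
      (P : GL (Fin 4) (PadicAlgCl p)) (rint : Field.absoluteGaloisGroup ℚ →* GL (Fin 4) (Valued.integer (PadicAlgCl p)))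
      (h : GL (Fin 4) k) (B : Field.absoluteGaloisGroup ℚ → Matrix (Fin 2) (Fin 2) k),
      DetC p k σ σ' → Sh p k red σ σ' ρ →
      (∀ g, Matrix.GeneralLinearGroup.map (Valued.integer (PadicAlgCl p)).subtype (rint g) = P⁻¹ * ρ g * P) →
      (∀ g, (Matrix.GeneralLinearGroup.map red (rint g)).val =
        h.val * Matrix.reindex finSumFinEquiv finSumFinEquiv (Matrix.fromBlocks (σ g).val (B g) 0 (σ' g).val) * (h⁻¹).val) →
      (∀ g g', B (g * g') = (σ g).val * B g' + B g * (σ' g').val) ∧ IsLocallyConstant B ∧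
      (∀ v : HeightOneSpectrum (NumberField.RingOfIntegers ℚ), ρ.IsUnramifiedAt v →
        ∀ 𝔓 ∈ v.primesAbove, ∀ i ∈ 𝔓.inertia (Field.absoluteGaloisGroup ℚ), B i = 0) ∧
      (∀ v : HeightOneSpectrum (NumberField.RingOfIntegers ℚ), ((p : ℕ) : NumberField.RingOfIntegers ℚ) ∈ v.asIdeal →
        ∃ (X₀ : Matrix (Fin 2) (Fin 2) k) (x₁ y₁ : Fin 2 → k), x₁ ≠ 0 ∧ y₁ ≠ 0 ∧
          (∀ τ : Field.absoluteGaloisGroup (v.adicCompletion ℚ), ∃ a : k,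
            (σ (absGaloisRestrict ℚ (v.adicCompletion ℚ) τ)).val *ᵥ x₁ = a • x₁) ∧
          (∀ τ : Field.absoluteGaloisGroup (v.adicCompletion ℚ), ∃ b : k,
            (σ' (absGaloisRestrict ℚ (v.adicCompletion ℚ) τ)).val *ᵥ y₁ = b • y₁) ∧
          (∀ τ : Field.absoluteGaloisGroup (v.adicCompletion ℚ), ∃ c : k,
            (B (absGaloisRestrict ℚ (v.adicCompletion ℚ) τ) -
              ((σ (absGaloisRestrict ℚ (v.adicCompletion ℚ) τ)).val * X₀ -
                X₀ * (σ' (absGaloisRestrict ℚ (v.adicCompletion ℚ) τ)).val)) *ᵥ y₁ = c • x₁) ∧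
          (∀ τ ∈ absInertia (v.adicCompletion ℚ),
            (σ (absGaloisRestrict ℚ (v.adicCompletion ℚ) τ)).val *ᵥ x₁ = x₁) ∧
          (∀ τ ∈ absInertia (v.adicCompletion ℚ),
            (σ' (absGaloisRestrict ℚ (v.adicCompletion ℚ) τ)).val *ᵥ y₁ = y₁) ∧
          (∀ τ ∈ absInertia (v.adicCompletion ℚ),
            (B (absGaloisRestrict ℚ (v.adicCompletion ℚ) τ) -
              ((σ (absGaloisRestrict ℚ (v.adicCompletion ℚ) τ)).val * X₀ -
                X₀ * (σ' (absGaloisRestrict ℚ (v.adicCompletion ℚ) τ)).val)) *ᵥ y₁ = 0) ∧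
          ∀ τ ∈ absInertia (v.adicCompletion ℚ), ∀ y : Fin 2 → k, ∃ c : k,
            (B (absGaloisRestrict ℚ (v.adicCompletion ℚ) τ) -
              ((σ (absGaloisRestrict ℚ (v.adicCompletion ℚ) τ)).val * X₀ -
                X₀ * (σ' (absGaloisRestrict ℚ (v.adicCompletion ℚ) τ)).val)) *ᵥ y = c • x₁) := by
  intro p _ hp k _ _ _ _ _ red σ σ' ρ P rint h B hDet hSh hP hred
  obtain ⟨hcoc, hlc, hur, -⟩ := stub_realisedClassSelmer p hp k red σ σ' ρ P rint h B hDet hSh hP hred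
  exact ⟨hcoc, hlc, hur, fun v hv => stub_greenbergStablePlane p hp k red σ σ' ρ P rint h B v hv hDet hSh hP hred⟩

end Summit.Langlands.Langlands.Cruxes.ResiduallyYoshidaLifting.SectorKlingenSplit.Fibre

end
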